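/-
Copyright: the b2b-balaban cell (near-miss cell 7), T⁴-continuum fan-out, NE7b ROUND-2 swarm `t4-ne7b-formalise-*`
(seat leaf-07, gen 2), row S6f «window-drop steps in the zone calculus» of lineage t4-ne7b-p1's claim table
`LEAVES-NE7b.md` (R-OWNER-22-2 (U2)).  Part IIb: the levelled tolerant reading READ OFF BIRTH REGIONS.
Released under the licence of the surrounding project.
-/
import Summits.QuantumFields.BalabanUV.T4Continuum.Support.HistoryZonesDrops

/-!
# History zones with window-drop steps, IIb: the levelled tolerant zone map READ OFF THE TAGGED BIRTH REGIONS

Summits-side support leaf of the T⁴-continuum cell (rung (B)+1 on a FINITE torus only; NOT infinite volume, NOT the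
mass gap, NOT the Clay statement; NOT a proof of the spine estimate NE7b).  NE7b ROUND-2 swarm, row **S6f** (window-drop
steps), follow-through of `Support/HistoryZonesDrops.lean`: there the levelled tolerant reading `ZoneReadingD sh n L K lv
Cb c G zone` is a HYPOTHESIS SHAPE; here it is INHABITED by the zone map read off the tagged births' regions, exactly as
leaf-01's `HistoryShapeRegions.zoneReading_of_birthRegionsS` inhabits the step-indexed reading — but AT LEVELS (the
step-`t` cube lattice is the level-`lv t` blocking) and WITH THE COLLAR `c` of leaf-01's tolerant reading
(`HistoryZonesTolerant`, owner's ruling R-OWNER-22-12 (1) = T-a: zones := thickened blockings of print-faithful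
regions).  For `lv = id` this is the zone half of leaf-01's planned pt 3b (`regZoneC := thickT c ∘ regZoneS`); the
ℤ^d-orbit → torus transport and «`Touch` of S-image orbits ⇒ contact» remain with S6 pt 3b∕3c (leaf-01).  [folklore]
bookkeeping∕finite geometry on the lineage's OWN index model; nothing is quoted from print, nothing printed is
asserted, no `[cite:]` tag, no `Prop` fact minted (`BirthRegionsD` is a HYPOTHESIS SHAPE).

WHAT.  §1 composite blockings (`blocks a ∘ blocks b = blocks (b·a)`).  §2 **`regZoneD sh n L K lv c reg t X`** := the
`c`-thickening, on the level-`lv t` torus, of `coreZoneD` = the union over the births `b` of `X` dated `≤ t` of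
`blocks (L^{lv t − lv (sh b).step}) (reg b)`; renewals add nothing, mergers take unions, a bare birth's zone at its own
step is `thickT c (reg b)`.  §3 **`BirthRegionsD sh n L K lv Cb c G reg`** (the three birth-region laws at levels:
`reg b` in range of level `lv (sh b).step`, `diam ≤ Cb·wtPEv (sh b)`, CONTACT of the partners' `regZoneD` zones at the
merger's shape-step) and **`zoneReadingD_of_birthRegionsD`**: `1 ≤ L`, `LevelFn K lv`, `Chrono (step∘sh) G` ⇒
`ZoneReadingD sh n L K lv (Cb + 2c) c G (regZoneD sh n L K lv c reg)`.  §4 the positional facts at levels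
(`isScale_root_of_leafStepsD`, `root_block_mem_regZoneD`) and the two consumers **`admZ_of_birthRegionsD`**,
**`card_admZSet_le_of_birthRegionsD`** (row S6's multiplicity shape with `Kz ↦ σ^{−2d}·Kz`, any rate `0 < σ < 1`,
`1 ≤ L·σ⁴`).  §5 the index-model form **`birthRegionsD_of_faceConnected`** (`reg b = redZone (n·L^{K − lv (sh b).step})
(Z b)`, `Cb = 4·2^d`, contact displayed).  §6 sanity.

HONEST DEPENDENCY (cell): continuum YM on T⁴ ⇐ BetaPertH ∧ nine spine estimates (0/9 proved); BetaPertH ⇐ (D1) ∧ (D4)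
∧ CAP+tail; G-an2-4 gates asym, D1 and NE2/3/4.  This file changes none of it.  NE7b NOT proved.
-/

open Finset
open Literature.MathematicalPhysics.QuantumFieldTheory.Balaban1983to89
open Literature.MathematicalPhysics.QuantumFieldTheory.Balaban1983to89.B13ScaleTransfer
open Literature.MathematicalPhysics.QuantumFieldTheory.Balaban1983to89.TreeLength
open T4PersistenceDictionary T4PartnerMultiplicity
open Summit.QuantumFields.BalabanUV.T4Continuum.PlacementSkeleton
open Summit.QuantumFields.BalabanUV.T4Continuum.Crowding
open Summit.QuantumFields.BalabanUV.T4Continuum.ZoneSkeleton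
open Summit.QuantumFields.BalabanUV.T4Continuum.ZoneCrowd
open Summit.QuantumFields.BalabanUV.T4Continuum.ZoneTorus

namespace Summit.QuantumFields.BalabanUV.T4Continuum.HistoryZones

noncomputable section

variable {d : ℕ} {ε : Type*} [DecidableEq ε] (sh : ε → PEv)

/-! ## §1 Composite blockings -/

omit [DecidableEq ε] sh in
/-- blocking by `b` then by `a` is blocking by `b·a` (one vector) [folklore] -/
theorem blockVec_blockVec (a b : ℕ) (u : Fin d → ℕ) : blockVec a (blockVec b u) = blockVec (b * a) u := by
  funext i
  simp [blockVec, Nat.div_div_eq_div_mul]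

omit [DecidableEq ε] sh in
/-- blocking by `b` then by `a` is blocking by `b·a` (zones) [folklore] -/
theorem blocks_blocks (a b : ℕ) (S : Finset (Fin d → ℕ)) : blocks a (blocks b S) = blocks (b * a) S := by
  rw [blocks, blocks, blocks, image_image]
  exact image_congr fun u _ => blockVec_blockVec a b u

omit [DecidableEq ε] sh in
/-- the block of a member is a member of the blocking [folklore] -/
theorem blockVec_mem_blocks (a : ℕ) {S : Finset (Fin d → ℕ)} {u : Fin d → ℕ} (hu : u ∈ S) :
    blockVec a u ∈ blocks a S :=
  mem_image_of_mem _ hu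

/-! ## §2 The levelled tolerant zone map read off the birth regions -/

/-- THE CORE ZONE AT LEVELS: the union over the births `b` of `X` dated `≤ t` of the blocking of `reg b` from level
`lv (sh b).step` to level `lv t`. [folklore] -/
def coreZoneD (L : ℕ) (lv : ℕ → ℕ) (reg : ε → Finset (Fin d → ℕ)) (t : ℕ) (X : Gen ε) : Finset (Fin d → ℕ) :=
  (births X).biUnion fun b => if (sh b).step ≤ t then blocks (L ^ (lv t - lv (sh b).step)) (reg b) else ∅

/-- **THE LEVELLED TOLERANT ZONE OF A STRUCTURE AT STEP `t`, READ OFF ITS TAGGED BIRTH REGIONS**: the `c`-thickening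
on the level-`lv t` torus of the core zone. [folklore] -/
def regZoneD (n L K : ℕ) (lv : ℕ → ℕ) (c : ℕ) (reg : ε → Finset (Fin d → ℕ)) (t : ℕ) (X : Gen ε) :
    Finset (Fin d → ℕ) :=
  thickT (n * L ^ (K - lv t)) c (coreZoneD sh L lv reg t X)

variable {sh}

/-- membership in the core zone [folklore] -/
theorem mem_coreZoneD {L : ℕ} {lv : ℕ → ℕ} {reg : ε → Finset (Fin d → ℕ)} {t : ℕ} {X : Gen ε} {u : Fin d → ℕ} :
    u ∈ coreZoneD sh L lv reg t X ↔
      ∃ b ∈ births X, (sh b).step ≤ t ∧ u ∈ blocks (L ^ (lv t - lv (sh b).step)) (reg b) := by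
  rw [coreZoneD, mem_biUnion]
  refine exists_congr fun b => and_congr_right fun _ => ?_
  split_ifs with h <;> simp [h]

/-- a blocked birth region of a birth already happened lies in the core zone [folklore] -/
theorem blocks_subset_coreZoneD {L : ℕ} {lv : ℕ → ℕ} {reg : ε → Finset (Fin d → ℕ)} {t : ℕ} {X : Gen ε} {b : ε}
    (hb : b ∈ births X) (hbt : (sh b).step ≤ t) :
    blocks (L ^ (lv t - lv (sh b).step)) (reg b) ⊆ coreZoneD sh L lv reg t X :=
  fun _ hu => mem_coreZoneD.2 ⟨b, hb, hbt, hu⟩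

/-- a renewal adds nothing (core) [folklore] -/
@[simp] theorem coreZoneD_renew (L : ℕ) (lv : ℕ → ℕ) (reg : ε → Finset (Fin d → ℕ)) (t : ℕ) (X : Gen ε) (e : ε)
    (h : ℕ) : coreZoneD sh L lv reg t (Gen.renew X e h) = coreZoneD sh L lv reg t X := rfl

/-- a merger's core zone is the union of the partners' [folklore] -/
theorem coreZoneD_merge (L : ℕ) (lv : ℕ → ℕ) (reg : ε → Finset (Fin d → ℕ)) (t : ℕ) (X Y : Gen ε) (e : ε) :
    coreZoneD sh L lv reg t (Gen.merge X Y e) = coreZoneD sh L lv reg t X ∪ coreZoneD sh L lv reg t Y := by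
  simp only [coreZoneD, births_merge, union_biUnion]

/-- the core zone of a bare birth at its own shape-step is its birth region [folklore] -/
@[simp] theorem coreZoneD_born_self (L : ℕ) (lv : ℕ → ℕ) (reg : ε → Finset (Fin d → ℕ)) (b : ε) (j : ℕ) :
    coreZoneD sh L lv reg (sh b).step (Gen.born b j) = reg b := by
  simp [coreZoneD, blocks_one]

/-- a renewal adds nothing [folklore] -/
@[simp] theorem regZoneD_renew (n L K : ℕ) (lv : ℕ → ℕ) (c : ℕ) (reg : ε → Finset (Fin d → ℕ)) (t : ℕ)
    (X : Gen ε) (e : ε) (h : ℕ) : regZoneD sh n L K lv c reg t (Gen.renew X e h) = regZoneD sh n L K lv c reg t X :=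
  rfl

/-- a merger's zone is the union of the partners' zones (the thickening distributes) [folklore] -/
theorem regZoneD_merge (n L K : ℕ) (lv : ℕ → ℕ) (c : ℕ) (reg : ε → Finset (Fin d → ℕ)) (t : ℕ) (X Y : Gen ε)
    (e : ε) : regZoneD sh n L K lv c reg t (Gen.merge X Y e) =
      regZoneD sh n L K lv c reg t X ∪ regZoneD sh n L K lv c reg t Y := by
  rw [regZoneD, coreZoneD_merge, thickT_union]; rfl

/-- the zone of a bare birth at its own shape-step is the thickened birth region [folklore] -/
@[simp] theorem regZoneD_born_self (n L K : ℕ) (lv : ℕ → ℕ) (c : ℕ) (reg : ε → Finset (Fin d → ℕ)) (b : ε)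
    (j : ℕ) : regZoneD sh n L K lv c reg (sh b).step (Gen.born b j) = thickT (n * L ^ (K - lv (sh b).step)) c (reg b) := by
  rw [regZoneD, coreZoneD_born_self]

variable (sh)

/-! ## §3 The birth-region laws at levels; the reading -/

/-- **THE BIRTH-REGION LAWS AT LEVELS ALONG A SHAPE MAP** (hypothesis shape; `HistoryShapeRegions.BirthRegionsS` at
levels with the tolerant zones): every tagged birth's region is in range of the level `lv (sh b).step` of its
shape-step; spans at most `Cb·wtPEv (sh b)` cells there; and at every merger node the partners' levelled tolerant zones
SHARE a cell at the merger's shape-step (CONTACT — supplied by S6 pt 3b∕3c from `Touch` of the S-image orbits).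
[folklore] -/
structure BirthRegionsD (n L K : ℕ) (lv : ℕ → ℕ) (Cb : ℝ) (c : ℕ) (G : Gen ε) (reg : ε → Finset (Fin d → ℕ)) :
    Prop where
  /-- birth regions are level-`lv (sh b).step` zones of the cutoff-`K` torus -/
  inRange : ∀ b ∈ births G, InRange (n * L ^ (K - lv (sh b).step)) (reg b)
  /-- a birth region spans at most `Cb·wtPEv (sh b)` cells of its level -/
  diam_le : ∀ b ∈ births G, (diam (n * L ^ (K - lv (sh b).step)) (reg b) : ℝ) ≤ Cb * wtPEv (sh b)
  /-- merger contact: the partners' levelled tolerant zones share a cell at the merger's shape-step -/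
  contact : ∀ (X Y : Gen ε) (e : ε), Sub (Gen.merge X Y e) G →
    ∃ z, z ∈ regZoneD sh n L K lv c reg (sh e).step X ∧ z ∈ regZoneD sh n L K lv c reg (sh e).step Y

variable {sh}

/-- the core zone of a sub-structure is in range of its level (level function: monotone) [folklore] -/
theorem inRange_coreZoneD {n L K : ℕ} (hL : 1 ≤ L) {lv : ℕ → ℕ} (hlv : LevelFn K lv) {Cb : ℝ} {c : ℕ} {G : Gen ε}
    {reg : ε → Finset (Fin d → ℕ)} (hB : BirthRegionsD sh n L K lv Cb c G reg) {X : Gen ε} (hs : Sub X G) (t : ℕ) :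
    InRange (n * L ^ (K - lv t)) (coreZoneD sh L lv reg t X) := by
  intro u hu
  obtain ⟨b, hb, hbt, hu⟩ := mem_coreZoneD.1 hu
  have hr := hB.inRange b (births_subset_of_subE hs hb)
  have hmono : lv (sh b).step ≤ lv t := hlv.monotone hbt
  have hle : n * L ^ (K - lv (sh b).step) ≤ n * L ^ (K - lv t) * L ^ (lv t - lv (sh b).step) := by
    rw [mul_assoc, ← pow_add]
    exact Nat.mul_le_mul_left _ (Nat.pow_le_pow_right hL (by omega))
  exact inRange_blocks (Nat.one_le_pow _ _ hL) (inRange_mono hle hr) u hu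

/-- the zone of every structure is in range of its level (a thickening is in range by construction) [folklore] -/
theorem inRange_regZoneD (n L K : ℕ) (lv : ℕ → ℕ) (c : ℕ) (reg : ε → Finset (Fin d → ℕ)) (t : ℕ) (X : Gen ε) :
    InRange (n * L ^ (K - lv t)) (regZoneD sh n L K lv c reg t X) :=
  inRange_thickT _ c _

/-- **THE BIRTH REGIONS GIVE THE LEVELLED TOLERANT READING.**  `L ≥ 1`, `LevelFn K lv`, `G` chronological for
`step ∘ sh`, birth regions obeying the three laws at levels ⇒ `ZoneReadingD sh n L K lv (Cb + 2c) c G (regZoneD …)`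
(the thickening adds `2c ≤ 2c·wtPEv` to a birth's diameter). [folklore] -/
theorem zoneReadingD_of_birthRegionsD {n L K : ℕ} (hL : 1 ≤ L) {lv : ℕ → ℕ} (hlv : LevelFn K lv) {Cb : ℝ} {c : ℕ}
    {G : Gen ε} (hchr : Chrono (PEv.step ∘ sh) G) {reg : ε → Finset (Fin d → ℕ)}
    (hB : BirthRegionsD sh n L K lv Cb c G reg) :
    ZoneReadingD sh n L K lv (Cb + 2 * c) c G (regZoneD sh n L K lv c reg) where
  inRange t X _ := inRange_regZoneD n L K lv c reg t X
  birth b j hs := by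
    rw [regZoneD_born_self]
    have hb : b ∈ births G := births_subset_of_subE hs (by simp)
    have h1 := diam_thickT_le c (hB.inRange b hb)
    have h2 := hB.diam_le b hb
    have hw : (1 : ℝ) ≤ wtPEv (sh b) := one_le_wtPEv _
    have hc0 : (0 : ℝ) ≤ c := Nat.cast_nonneg c
    calc (diam (n * L ^ (K - lv (sh b).step)) (thickT (n * L ^ (K - lv (sh b).step)) c (reg b)) : ℝ)
        ≤ diam (n * L ^ (K - lv (sh b).step)) (reg b) + 2 * c := by exact_mod_cast h1
      _ ≤ Cb * wtPEv (sh b) + 2 * c * wtPEv (sh b) := by nlinarith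
      _ = (Cb + 2 * c) * wtPEv (sh b) := by ring
  union X Y e hs := by rw [regZoneD_merge]
  overlap := hB.contact
  step X t hs hft hK := by
    -- every birth of `X` is dated `≤ t`; its blocking to level `lv (t+1)` is the further blocking of its blocking to
    -- level `lv t`, which lies in the (thickened) zone at `t`
    have hcore : coreZoneD sh L lv reg (t + 1) X ⊆
        blocks (L ^ (lv (t + 1) - lv t)) (regZoneD sh n L K lv c reg t X) := by
      intro u hu
      obtain ⟨b, hb, -, hu⟩ := mem_coreZoneD.1 hu
      have hbt : (sh b).step ≤ t :=
        (st_le_ftime_of_chrono (PEv.step ∘ sh) (chrono_of_sub (PEv.step ∘ sh) hs hchr) b hb).trans hft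
      have hm1 : lv (sh b).step ≤ lv t := hlv.monotone hbt
      have hm2 : lv t ≤ lv (t + 1) := hlv.mono t
      have heq : L ^ (lv (t + 1) - lv (sh b).step) = L ^ (lv t - lv (sh b).step) * L ^ (lv (t + 1) - lv t) := by
        rw [← pow_add]; congr 1; omega
      rw [heq, ← blocks_blocks] at hu
      refine blocks_mono' _ ?_ hu
      exact (blocks_subset_coreZoneD hb hbt).trans
        (subset_thickT c (inRange_coreZoneD hL hlv hB hs t))
    exact (thickT_mono _ c hcore)
  renew X e h t hs := by rw [regZoneD_renew]
where
  /-- blocking is monotone in the zone [folklore] -/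
  blocks_mono' (a : ℕ) {S T : Finset (Fin d → ℕ)} (h : S ⊆ T) : blocks a S ⊆ blocks a T := image_subset_image h

/-! ## §4 The positional facts at levels and the two consumers -/

/-- **(p1) AT LEVELS: ROOT CELLS ARE CELLS OF THE LEVEL OF THEIR ROOT SCALE** — from leaf steps and the placement of
every birth on a cell of scale `lv (sh b).step`. [folklore] -/
theorem isScale_root_of_leafStepsD {n L K : ℕ} (lv : ℕ → ℕ) {G : Gen ε}
    (hG : ∀ (b : ε) (j : ℕ), Sub (Gen.born b j) G → (sh b).step = j) {E : Finset ε} {G' : Gen ↥E}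
    (hGG : gmap Subtype.val G' = G) (P₀ : ↥E → TCell d (n * L ^ K))
    (hP : ∀ b : ↥E, b.1 ∈ births G → IsScale L (lv (sh b.1).step) (P₀ b)) :
    ∀ X' : Gen ↥E, Sub X' G' → IsScale L (lv X'.rootStep) (P₀ X'.root) := by
  intro X' hX'
  have hs : Sub (gmap Subtype.val X') G := hGG ▸ sub_gmap Subtype.val hX'
  have hroot : (X'.root).1 ∈ births G :=
    births_subset_of_subE hs (by simpa using root_mem_births (gmap Subtype.val X'))
  have hst : X'.rootStep = (sh (X'.root).1).step := by
    have h := rootStep_eq_root_stepS hG hs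
    simpa using h
  rw [hst]
  exact hP X'.root hroot

/-- the root block AT LEVEL `lv s` of a sub-structure formed by step `s` lies in its zone at `s` [folklore] -/
theorem root_block_mem_regZoneD_of_le {n L K : ℕ} (hL : 1 ≤ L) {lv : ℕ → ℕ} (hlv : LevelFn K lv) {Cb : ℝ} {c : ℕ}
    {G : Gen ε} (hchr : Chrono (PEv.step ∘ sh) G) {reg : ε → Finset (Fin d → ℕ)}
    (hB : BirthRegionsD sh n L K lv Cb c G reg) {E : Finset ε} {G' : Gen ↥E} (hGG : gmap Subtype.val G' = G)
    (P₀ : ↥E → TCell d (n * L ^ K))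
    (hP : ∀ b : ↥E, b.1 ∈ births G → (fun i => (P₀ b i).val / L ^ lv (sh b.1).step) ∈ reg b.1)
    {X' : Gen ↥E} (hX' : Sub X' G') {s : ℕ} (hs : ftime (PEv.step ∘ sh) (gmap Subtype.val X') ≤ s) :
    (fun i => (P₀ X'.root i).val / L ^ lv s) ∈ regZoneD sh n L K lv c reg s (gmap Subtype.val X') := by
  have hsub : Sub (gmap Subtype.val X') G := hGG ▸ sub_gmap Subtype.val hX'
  have hrX : (X'.root).1 ∈ births (gmap Subtype.val X') := by
    simpa using root_mem_births (gmap Subtype.val X')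
  have hle : (sh (X'.root).1).step ≤ s :=
    (st_le_ftime_of_chrono (PEv.step ∘ sh) (chrono_of_sub (PEv.step ∘ sh) hsub hchr) _ hrX).trans hs
  have hlvle : lv (sh (X'.root).1).step ≤ lv s := hlv.monotone hle
  refine subset_thickT c (inRange_coreZoneD hL hlv hB hsub s) (mem_coreZoneD.2 ⟨(X'.root).1, hrX, hle, ?_⟩)
  have heq : (fun i => (P₀ X'.root i).val / L ^ lv s) =
      blockVec (L ^ (lv s - lv (sh (X'.root).1).step))
        (fun i => (P₀ X'.root i).val / L ^ lv (sh (X'.root).1).step) := by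
    funext i
    rw [blockVec, Nat.div_div_eq_div_mul, ← pow_add, Nat.add_sub_cancel' hlvle]
  rw [heq]
  exact blockVec_mem_blocks _ (hP X'.root (births_subset_of_subE hsub hrX))

/-- **(p2) AT LEVELS: AT A MERGER BOTH PARTNERS' ROOT BLOCKS LIE IN THEIR ZONES.** [folklore] -/
theorem root_block_mem_regZoneD {n L K : ℕ} (hL : 1 ≤ L) {lv : ℕ → ℕ} (hlv : LevelFn K lv) {Cb : ℝ} {c : ℕ}
    {G : Gen ε} (hchr : Chrono (PEv.step ∘ sh) G) {reg : ε → Finset (Fin d → ℕ)}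
    (hB : BirthRegionsD sh n L K lv Cb c G reg) {E : Finset ε} {G' : Gen ↥E} (hGG : gmap Subtype.val G' = G)
    (P₀ : ↥E → TCell d (n * L ^ K))
    (hP : ∀ b : ↥E, b.1 ∈ births G → (fun i => (P₀ b i).val / L ^ lv (sh b.1).step) ∈ reg b.1) :
    ∀ (X' Y' : Gen ↥E) (e' : ↥E), Sub (Gen.merge X' Y' e') G' →
      (fun i => (P₀ X'.root i).val / L ^ lv (sh e'.1).step) ∈
          regZoneD sh n L K lv c reg (sh e'.1).step (gmap Subtype.val X') ∧
        (fun i => (P₀ Y'.root i).val / L ^ lv (sh e'.1).step) ∈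
          regZoneD sh n L K lv c reg (sh e'.1).step (gmap Subtype.val Y') := by
  intro X' Y' e' hm
  have hsub : Sub (gmap Subtype.val (Gen.merge X' Y' e')) G := hGG ▸ sub_gmap Subtype.val hm
  have hchr' : Chrono (PEv.step ∘ sh) (Gen.merge (gmap Subtype.val X') (gmap Subtype.val Y') e'.1) :=
    chrono_of_sub (PEv.step ∘ sh) hsub hchr
  obtain ⟨hfX, hfY⟩ := ftime_le_of_chrono (PEv.step ∘ sh) hchr'
  simp only [Function.comp_apply] at hfX hfY
  exact ⟨root_block_mem_regZoneD_of_le hL hlv hchr hB hGG P₀ hP (Sub.trans (Sub.left Y' e' (Sub.refl X')) hm) hfX,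
    root_block_mem_regZoneD_of_le hL hlv hchr hB hGG P₀ hP (Sub.trans (Sub.right X' e' (Sub.refl Y')) hm) hfY⟩

section Consumers

open scoped Classical

/-- **THE REALIZED PLACEMENT IS ZONE-ADMISSIBLE AT LEVELS** from the birth regions along `sh` (deflator `theta lv ϑ`,
`0 < ϑ ≤ 1`). [folklore] -/
theorem admZ_of_birthRegionsD {n L K : ℕ} (hL : 1 ≤ L) {lv : ℕ → ℕ} (hlv : LevelFn K lv) {ϑ : ℝ} (hϑ : 0 < ϑ)
    (hϑ1 : ϑ ≤ 1) {Cb : ℝ} {c : ℕ} {G : Gen ε} (hchr : Chrono (PEv.step ∘ sh) G)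
    (hK : ∀ e ∈ G.events, (sh e).step ≤ K) (hG : ∀ (b : ε) (j : ℕ), Sub (Gen.born b j) G → (sh b).step = j)
    {reg : ε → Finset (Fin d → ℕ)} (hB : BirthRegionsD sh n L K lv Cb c G reg) {E : Finset ε} {G' : Gen ↥E}
    (hGG : gmap Subtype.val G' = G) (P₀ : ↥E → TCell d (n * L ^ K))
    (hPs : ∀ b : ↥E, b.1 ∈ births G → IsScale L (lv (sh b.1).step) (P₀ b))
    (hPr : ∀ b : ↥E, b.1 ∈ births G → (fun i => (P₀ b i).val / L ^ lv (sh b.1).step) ∈ reg b.1) :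
    AdmZ (nearD n L K lv (theta lv ϑ))
      (fun t Z => extD sh n L K lv ϑ G (regZoneD sh n L K lv c reg) t (gmap Subtype.val Z))
      ((PEv.step ∘ sh) ∘ Subtype.val) G' P₀ :=
  admZ_of_readingD sh hlv hϑ hϑ1 hchr hK (zoneReadingD_of_birthRegionsD hL hlv hchr hB) hGG P₀
    (isScale_root_of_leafStepsD lv hG hGG P₀ hPs) (root_block_mem_regZoneD hL hlv hchr hB hGG P₀ hPr)

/-- **THE (GM) MULTIPLICITY OF A TAGGED GENEALOGY WITH WINDOW-DROP STEPS, FROM ITS BIRTH REGIONS**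
(`card_admZSet_le_of_readingD` with the reading supplied by `zoneReadingD_of_birthRegionsD`): for ANY rate `σ` with
`0 < σ < 1`, `1 ≤ L·σ⁴`, with `c₀ := (2c+1)∕(1−σ²)`, `C₀ := max (Cb + 2c) (c₀ + 1)`, the bound
`(2^d σ^{−2d}(C₀ + 2c₀ + 1)^d)^{#merges G}·∏_{e ∈ merges G} Q(wcntS sh G,σ,(sh e).step)^d·(L^d)^{partnerAges (step∘sh) G}`.
[folklore] -/
theorem card_admZSet_le_of_birthRegionsD (W : ε → ℕ) (n : ℕ) {L : ℕ} (hL : 1 ≤ L) (K : ℕ) {lv : ℕ → ℕ}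
    (hlv : LevelFn K lv) {Cb σ : ℝ} (hCb : 0 ≤ Cb) (h0 : 0 < σ) (h1 : σ < 1) (hσL : 1 ≤ (L : ℝ) * σ ^ 4) {c : ℕ}
    {G : Gen ε} (hW : G.WF W) (hchr : Chrono (PEv.step ∘ sh) G) (hk0 : ∀ b ∈ births G, (sh b).kind = 0)
    (hk2 : ∀ m ∈ merges G, (sh m).kind ≠ 0) {reg : ε → Finset (Fin d → ℕ)}
    (hB : BirthRegionsD sh n L K lv Cb c G reg) (E : Finset ε) (hE : G.events ⊆ E) (z c₀' : TCell d (n * L ^ K)) :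
    ((admZSet (nearD n L K lv (theta lv (σ ^ 2)))
        (fun t Z => extD sh n L K lv (σ ^ 2) G (regZoneD sh n L K lv c reg) t (gmap Subtype.val Z))
        ((PEv.step ∘ sh) ∘ Subtype.val) (grestrict E G hE) (grestrict E G hE).root z c₀').card : ℝ) ≤
      ((2 : ℝ) ^ d * (σ ^ 2)⁻¹ ^ d *
          (max (Cb + 2 * c) ((2 * c + 1) / (1 - σ ^ 2) + 1) + 2 * ((2 * c + 1) / (1 - σ ^ 2)) + 1) ^ d) ^
          (merges G).card *
        (∏ e ∈ merges G, Q (wcntS sh G) σ (sh e).step ^ (d : ℝ)) *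
          ((L : ℝ) ^ d) ^ partnerAges (PEv.step ∘ sh) G :=
  card_admZSet_le_of_readingD sh W n hL K hlv (by positivity) h0 h1 hσL hW hchr hk0 hk2
    (zoneReadingD_of_birthRegionsD hL hlv hchr hB) E hE z c₀'

end Consumers

/-! ## §5 The index-model form at levels: birth regions as reduced face-connected cube families -/

variable (sh)

/-- **THE LAWS `inRange`∕`diam_le` AT LEVELS DISCHARGED IN THE INDEX MODEL, `Cb = 4·2^d`** (one cell ≡ one
`MR_j`-cube = one level-`lv j` block): every birth `b` of `G` has a kind-`0` shape and its region is the reduced cube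
family `redZone (n·L^{K − lv (sh b).step}) (Z b)` of a non-empty face-connected `Z b ⊆ ℤ^d` of tree length `≤ (sh b).fat`;
the contact law is the history's datum (S6 pt 3b∕3c). [folklore] -/
theorem birthRegionsD_of_faceConnected {n L K : ℕ} (hn : 1 ≤ n) (hL : 1 ≤ L) (lv : ℕ → ℕ) (c : ℕ) {G : Gen ε}
    (Z : ε → Finset (Pt d)) (hne : ∀ b ∈ births G, (Z b).Nonempty)
    (hfc : ∀ b ∈ births G, FaceConnected (Z b)) (hfat : ∀ b ∈ births G, treeLen (Z b) ≤ (sh b).fat)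
    (hk0 : ∀ b ∈ births G, (sh b).kind = 0)
    (hcontact : ∀ (X Y : Gen ε) (e : ε), Sub (Gen.merge X Y e) G →
      ∃ z, z ∈ regZoneD sh n L K lv c (fun b => redZone (n * L ^ (K - lv (sh b).step)) (Z b)) (sh e).step X ∧
        z ∈ regZoneD sh n L K lv c (fun b => redZone (n * L ^ (K - lv (sh b).step)) (Z b)) (sh e).step Y) :
    BirthRegionsD sh n L K lv (4 * 2 ^ d) c G (fun b => redZone (n * L ^ (K - lv (sh b).step)) (Z b)) where
  inRange b _ := inRange_redZone (Nat.mul_pos hn (pow_pos hL _)) (Z b)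
  diam_le b hb := by
    rw [wtPEv_of_kind0 (hk0 b hb)]
    exact diam_redZone_le_fat (Nat.mul_pos hn (pow_pos hL _)) (hne b hb) (hfc b hb) (hfat b hb)
  contact := hcontact

/-! ## §6 Sanity (decided) -/

namespace SanityDR

/-- regions of the tagged births of `HistoryShapeCrowd.Sanity.twinT` (two class-`1` regions born at step `0`, merged
at step `1`): tag `7` ↦ `{4,5}`, tag `8` ↦ `{5,6}`, else empty -/
def regD : PEv × ℕ → Finset (Fin 1 → ℕ) := fun ℓ =>
  if ℓ.2 = 7 then {![4], ![5]} else if ℓ.2 = 8 then {![5], ![6]} else ∅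

/-- with the plateau level function `lv 0 = lv 1 = 3` (a window drop between steps `0` and `1`) the core zone at step
`1` is NOT blocked: still `{4,5,6}`; with the drop-free `lv = id` it is blocked by `L = 2` to `{2,3}` -/
example : coreZoneD Prod.fst 2 (fun t => if t ≤ 1 then 3 else t + 2) regD 1 HistoryZones.Sanity.twinT =
      {![4], ![5], ![6]} ∧
    coreZoneD Prod.fst 2 (fun t => t) regD 1 HistoryZones.Sanity.twinT = {![2], ![3]} := by decide

end SanityDR

end

end Summit.QuantumFields.BalabanUV.T4Continuum.HistoryZones
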